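import Mathlib.RingTheory.Localization.Ideal
import Mathlib.RingTheory.Localization.AtPrime.Basic
import Mathlib.RingTheory.Noetherian.Basic
import Mathlib.Tactic.LinearCombination
import HarnessLib

/-!
# Two finitely generated ideals which agree at a prime agree after inverting one element

Topic: `Literature/AlgebraicGeometry/Resolution`. The algebraic form of "equal germs of
coherent ideals are equal on a neighbourhood": for finitely generated ideals `J₁, J₂ ⊆ A` with
the same extension to the localization `A_𝔮` at a prime `𝔮`, there is `f ∉ 𝔮` such that
`J₁` and `J₂` have the same extension to every `A`-algebra in which `f` is invertible
(`exists_notMem_map_eq_of_map_eq_atPrime`). Used in the endgame of the crux `PicoverLocalModel`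
to spread, from the stalk `𝒪_{W,w}` to an affine basic neighbourhood of `w`, the equality of
a boundary ideal with the principal ideal of a spread equation, and its primality.

Sources: folklore (EGA 0_I, (5.2.7); Matsumura, *Commutative Ring Theory*, §4).
-/

namespace Literature.AlgebraicGeometry.Resolution

/-- An element of `A` whose image lies in the extension `J A_𝔮` of an ideal is multiplied into
`J` by some element outside `𝔮`. [folklore] -/
theorem exists_notMem_mul_mem_of_map_mem {A O : Type*} [CommRing A] [CommRing O] [Algebra A O]
    (𝔮 : Ideal A) [𝔮.IsPrime] [IsLocalization.AtPrime O 𝔮] {J : Ideal A} {z : A}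
    (hz : algebraMap A O z ∈ J.map (algebraMap A O)) : ∃ e ∉ 𝔮, e * z ∈ J := by
  obtain ⟨⟨⟨a, ha⟩, ⟨s, hs⟩⟩, h⟩ := (IsLocalization.mem_map_algebraMap_iff 𝔮.primeCompl O).mp hz
  simp only at h
  have h' : algebraMap A O (z * s - a) = 0 := by rw [map_sub, map_mul, h, sub_self]
  obtain ⟨⟨t, ht⟩, ht'⟩ := (IsLocalization.map_eq_zero_iff 𝔮.primeCompl O _).mp h'
  refine ⟨t * s, fun hmem => ?_, ?_⟩
  · rcases (‹𝔮.IsPrime›).mem_or_mem hmem with h1 | h1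
    · exact ht h1
    · exact hs h1
  · have : t * s * z = t * a := by
      have := ht'; simp only at this; linear_combination this
    rw [this]
    exact J.mul_mem_left _ ha

/-- **Finitely generated ideals which agree at a prime `𝔮` agree after inverting one element
outside `𝔮`.** [folklore] -/
theorem exists_notMem_map_eq_of_map_eq_atPrime {A O : Type*} [CommRing A] [CommRing O]
    [Algebra A O] (𝔮 : Ideal A) [𝔮.IsPrime] [IsLocalization.AtPrime O 𝔮] {J₁ J₂ : Ideal A}
    (h₁ : J₁.FG) (h₂ : J₂.FG) (h : J₁.map (algebraMap A O) = J₂.map (algebraMap A O)) :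
    ∃ f ∉ 𝔮, ∀ (L : Type*) [CommRing L] [Algebra A L], IsUnit (algebraMap A L f) →
      J₁.map (algebraMap A L) = J₂.map (algebraMap A L) := by
  classical
  obtain ⟨S₁, rfl⟩ := h₁
  obtain ⟨S₂, rfl⟩ := h₂
  have key₁ : ∀ z ∈ S₁, ∃ e ∉ 𝔮, e * z ∈ Ideal.span (S₂ : Set A) := fun z hz =>
    exists_notMem_mul_mem_of_map_mem 𝔮 (h ▸ Ideal.mem_map_of_mem _ (Ideal.subset_span hz))
  have key₂ : ∀ z ∈ S₂, ∃ e ∉ 𝔮, e * z ∈ Ideal.span (S₁ : Set A) := fun z hz =>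
    exists_notMem_mul_mem_of_map_mem 𝔮 (h.symm ▸ Ideal.mem_map_of_mem _ (Ideal.subset_span hz))
  choose! e₁ he₁ he₁' using key₁
  choose! e₂ he₂ he₂' using key₂
  refine ⟨(∏ z ∈ S₁, e₁ z) * ∏ z ∈ S₂, e₂ z, fun hmem => ?_, fun L _ _ hunit => ?_⟩
  · rcases (‹𝔮.IsPrime›).mem_or_mem hmem with h1 | h1
    · obtain ⟨z, hz, hz'⟩ := (‹𝔮.IsPrime›).prod_mem_iff.mp h1
      exact he₁ z hz hz'
    · obtain ⟨z, hz, hz'⟩ := (‹𝔮.IsPrime›).prod_mem_iff.mp h1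
      exact he₂ z hz hz'
  · rw [map_mul, IsUnit.mul_iff, map_prod, map_prod, IsUnit.prod_iff, IsUnit.prod_iff] at hunit
    obtain ⟨hu₁, hu₂⟩ := hunit
    apply le_antisymm
    · rw [Ideal.map_span, Ideal.span_le]
      rintro _ ⟨z, hz, rfl⟩
      have hmem := Ideal.mem_map_of_mem (algebraMap A L) (he₁' z hz)
      rw [map_mul] at hmem
      have := Ideal.mul_mem_left _ (↑(hu₁ z hz).unit⁻¹ : L) hmem
      rwa [← mul_assoc, IsUnit.val_inv_mul, one_mul] at this
    · rw [Ideal.map_span, Ideal.span_le]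
      rintro _ ⟨z, hz, rfl⟩
      have hmem := Ideal.mem_map_of_mem (algebraMap A L) (he₂' z hz)
      rw [map_mul] at hmem
      have := Ideal.mul_mem_left _ (↑(hu₂ z hz).unit⁻¹ : L) hmem
      rwa [← mul_assoc, IsUnit.val_inv_mul, one_mul] at this

end Literature.AlgebraicGeometry.Resolution
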